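import Mathlib
import Summits.ValiantsHypothesis.ValiantsHypothesis.Theorems.GeneratorObstructionsPowGenDegreeQPLinearFormDense

/-!
# K2 `PowGenDegreeQP` (stmt-ValiantsHypothesis-11655), line `trace-side-regimes`:
# the row `m = 1` of the window, for every `e` — generator types of `Δ_1(tr X_n)` have degree 1

Helper file (`--supports stmt-ValiantsHypothesis-11655`) for the registered stubs `stub_sliceGen`,
`stub_wideGen` of `Cruxes/GenFlipThesis/Lines/trace_side_regimes.lean` (third of three for the row
`m = 1`).  Both stubs and K2 itself quantify over ALL `1 ≤ m ≤ n = m + e` in the quasi-polynomial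
window; this file settles the bottom row `m = 1` (every `n`, every exponent) exactly, by the
Borel-density method of `…PowGenDegreeQPBorelDense.lean` applied to the linear form
`tr X_n = powFormLex k n 1 = ∑_i X_{(i,i)}` (`powFormLex_one_eq`), whose coefficient at the greatest
letter `T = (n-1, n-1)` is `1` (`diagCoeff_top`):

* `dense_powFormLex_one` — `tr X_n` is a Borel-dense point of `Δ_1(tr X_n)`;
* `eq_single_top_of_occurs_powFormLex_one`, `apply_eq_zero_of_occurs_rowOne` — occurring weights
  are multiples of `ε_T`;
* `neg_size_le_one_of_genType_rowOne` — **every generator type `χ` of `A(Δ_1(tr X_n))` has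
  `-|χ| ≤ 1`**, for every `n`;
* the row `m = 1` of K2 and of both registered stubs, in their exact shape with `m = 1` and ANY
  exponent `c₀`: `powGenDegreeQP_rowOne`, `stub_sliceGen_rowOne`, `stub_wideGen_rowOne`; in fact
  the wide regime is EMPTY at `m = 1` (`not_wide_genType_rowOne`).

Honest label: the degenerate bottom row of K2 (linear forms; the covariant algebra is `k[X_T]`);
rows `m ≥ 2` and both stubs stay OPEN.  Row `m = 2` (quadrics: generator types `-2ω_k`, `k ≤ n²`,
degree `k`) needs exactly one more input for the same method — the Cholesky density of
`B · (∑ xᵢ²)` in `Sym²`.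
-/

namespace Summit.ValiantsHypothesis.ValiantsHypothesis.Theorems.GeneratorObstructions.PowGenDegreeQP

open MvPolynomial
open Literature.NumberTheory.DiophantineGeometry Literature.Computability.AlgebraicComplexity

-- `Summit.ValiantsHypothesis.ValiantsHypothesis.…` is the tree's mandated single-conjunct layout.
set_option linter.dupNamespace false

noncomputable section

/-! ## 4. The power trace of exponent one -/

section TraceOne

variable (k : Type*) [Field k]

/-- `tr X_n = ∑_i X_{(i,i)}` as a linear form `∑_v c_v X_v` on `MatIdx n`, with `c` the indicator
of the diagonal letters. [cite: GesmundoIkenmeyerPanova2017, §2.2 (definition of Pow)] -/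
theorem powFormLex_one_eq (n : ℕ) :
    powFormLex k n 1 =
      ∑ v : MatIdx n, (∑ i : Fin n, if v = toLex (i, i) then (1 : k) else 0) • (X v : MvPolynomial (MatIdx n) k) := by
  classical
  have hL : powFormLex k n 1 = ∑ i : Fin n, (X (toLex (i, i)) : MvPolynomial (MatIdx n) k) := by
    rw [powFormLex, powTrace, pow_one, Matrix.trace]
    simp only [Matrix.diag_apply, Matrix.mvPolynomialX_apply, map_sum, rename_X]
  rw [hL]
  simp only [Finset.sum_smul, ite_smul, one_smul, zero_smul]
  rw [Finset.sum_comm]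
  refine Finset.sum_congr rfl fun i _ => ?_
  rw [Finset.sum_ite_eq' Finset.univ (toLex (i, i)), if_pos (Finset.mem_univ _)]

variable {k}

/-- The greatest letter of `MatIdx (n+1)` is `(n, n)`. [folklore] -/
theorem le_toLex_last (n : ℕ) (v : MatIdx (n + 1)) : v ≤ toLex (Fin.last n, Fin.last n) := by
  rw [← toLex_ofLex v, Prod.Lex.toLex_le_toLex]
  rcases (Fin.le_last (ofLex v).1).lt_or_eq with h | h
  · exact Or.inl h
  · exact Or.inr ⟨h, Fin.le_last _⟩

/-- The diagonal indicator has value `1` at the greatest letter `(n, n)`. [folklore] -/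
theorem diagCoeff_top (n : ℕ) :
    (∑ i : Fin (n + 1), if toLex (Fin.last n, Fin.last n) = toLex (i, i) then (1 : k) else 0) = 1 := by
  rw [Finset.sum_eq_single (Fin.last n)]
  · rw [if_pos rfl]
  · intro i _ hi
    rw [if_neg]
    intro h
    have h' := toLex.injective h
    rw [Prod.mk.injEq] at h'
    exact hi h'.1.symm
  · intro h; exact absurd (Finset.mem_univ _) h

/-- **Borel density of `tr X_n` itself** (`n ≥ 1`): a class of `k[Δ_1(tr X_n)]` vanishing at all
`b · tr X_n`, `b` upper triangular, is zero. [folklore] -/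
theorem dense_powFormLex_one [Infinite k] (n : ℕ) :
    ∀ x : OrbitCoordRing (powFormLex k (n + 1) 1) 1,
      (∀ b : GL (MatIdx (n + 1)) k, IsUpperTriangular b →
        evalAtPoint (powFormLex k (n + 1) 1) 1
          (orbitCoordRep (powFormLex k (n + 1) 1) 1 (b * 1)⁻¹ x) = 0) → x = 0 := by
  classical
  have key : ∀ f : MvPolynomial (MatIdx (n + 1)) k,
      f = ∑ v : MatIdx (n + 1), (∑ i : Fin (n + 1), if v = toLex (i, i) then (1 : k) else 0) •
        (X v : MvPolynomial (MatIdx (n + 1)) k) →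
      ∀ x : OrbitCoordRing f 1, (∀ b : GL (MatIdx (n + 1)) k, IsUpperTriangular b →
        evalAtPoint f 1 (orbitCoordRep f 1 (b * 1)⁻¹ x) = 0) → x = 0 := by
    rintro f rfl
    exact dense_linearForm (le_toLex_last n) (by rw [diagCoeff_top]; exact one_ne_zero)
  exact key _ (powFormLex_one_eq k (n + 1))

/-- **Occurring weights of `Δ_1(tr X_n)` are multiples of `ε_T`**, `T = (n-1, n-1)`
(characteristic zero). [folklore] -/
theorem eq_single_top_of_occurs_powFormLex_one [CharZero k] (n : ℕ) {χ : Weight (MatIdx (n + 1))}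
    (hχ : highestWeightSpace (orbitCoordRep (powFormLex k (n + 1) 1) 1) χ ≠ ⊥) :
    χ = Pi.single (toLex (Fin.last n, Fin.last n)) (χ (toLex (Fin.last n, Fin.last n))) := by
  classical
  have key : ∀ f : MvPolynomial (MatIdx (n + 1)) k,
      f = ∑ v : MatIdx (n + 1), (∑ i : Fin (n + 1), if v = toLex (i, i) then (1 : k) else 0) •
        (X v : MvPolynomial (MatIdx (n + 1)) k) →
      highestWeightSpace (orbitCoordRep f 1) χ ≠ ⊥ →
      χ = Pi.single (toLex (Fin.last n, Fin.last n)) (χ (toLex (Fin.last n, Fin.last n))) := by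
    rintro f rfl h
    exact eq_single_top_of_occurs (le_toLex_last n) (by rw [diagCoeff_top]; exact one_ne_zero) h
  exact key _ (powFormLex_one_eq k (n + 1)) hχ

/-- **Row `m = 1`: every generator type of `A(Δ_1(tr X_n))` has degree at most one**
(`-|χ| ≤ 1`; indeed `χ ∈ {0, -ε_T}`), for every `n` (for `n = 0` all weights are `0`).
[folklore] -/
theorem neg_size_le_one_of_genType_rowOne (n : ℕ) {χ : Weight (MatIdx n)}
    (hγ : Module.finrank ℂ
      (↥(highestWeightSpace (orbitCoordRep (powFormLex ℂ n 1) 1) χ) ⧸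
        Submodule.comap (highestWeightSpace (orbitCoordRep (powFormLex ℂ n 1) 1) χ).subtype
          (⨆ p : Weight (MatIdx n) × Weight (MatIdx n), ⨆ (_ : p.1 + p.2 = χ ∧ p.1 ≠ 0 ∧ p.2 ≠ 0),
            highestWeightSpace (orbitCoordRep (powFormLex ℂ n 1) 1) p.1 *
              highestWeightSpace (orbitCoordRep (powFormLex ℂ n 1) 1) p.2)) ≠ 0) :
    -(Weight.size χ) ≤ 1 := by
  classical
  cases n with
  | zero =>
    have h0 : Weight.size χ = 0 := Finset.sum_eq_zero fun i _ => ((ofLex i).1).elim0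
    rw [h0, neg_zero]
    exact zero_le_one
  | succ n =>
    have key : ∀ f : MvPolynomial (MatIdx (n + 1)) ℂ,
        f = ∑ v : MatIdx (n + 1), (∑ i : Fin (n + 1), if v = toLex (i, i) then (1 : ℂ) else 0) •
          (X v : MvPolynomial (MatIdx (n + 1)) ℂ) →
        Module.finrank ℂ (↥(highestWeightSpace (orbitCoordRep f 1) χ) ⧸
          Submodule.comap (highestWeightSpace (orbitCoordRep f 1) χ).subtype
            (⨆ p : Weight (MatIdx (n + 1)) × Weight (MatIdx (n + 1)),
              ⨆ (_ : p.1 + p.2 = χ ∧ p.1 ≠ 0 ∧ p.2 ≠ 0),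
                highestWeightSpace (orbitCoordRep f 1) p.1 * highestWeightSpace (orbitCoordRep f 1) p.2)) ≠ 0 →
        -(Weight.size χ) ≤ 1 := by
      rintro f rfl h
      exact neg_size_le_one_of_genType_linearForm (le_toLex_last n)
        (by rw [diagCoeff_top]; exact one_ne_zero) h
    exact key _ (powFormLex_one_eq ℂ (n + 1)) hγ

end TraceOne

/-! ## 5. The row `m = 1` of K2 and of the two registered stubs -/

section RowOne

/-- Window arithmetic: `1 ≤ (1 : ℤ) · 2^((log₂ 1 + c₀)^c₀)`. [folklore] -/
theorem one_le_rowOne_bound (c₀ : ℕ) : (1 : ℤ) ≤ ((1 : ℕ) : ℤ) * 2 ^ ((Nat.log 2 1 + c₀) ^ c₀) := by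
  rw [Nat.cast_one, one_mul]
  exact one_le_pow₀ (by norm_num)

/-- **K2 `PowGenDegreeQP`, row `m = 1`, every `e` and EVERY exponent `c₀`**: every generator type
`χ` of `A(Δ_1(tr X_{1+e}))` has `-|χ| ≤ 1 · 2^((log₂ 1 + c₀)^c₀)` (the body of K2 at `m = 1`; no
window hypothesis needed). [folklore] -/
theorem powGenDegreeQP_rowOne (c₀ e : ℕ) (χ : Weight (MatIdx (1 + e)))
    (hγ : Module.finrank ℂ
      (↥(highestWeightSpace (orbitCoordRep (powFormLex ℂ (1 + e) 1) 1) χ) ⧸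
        Submodule.comap (highestWeightSpace (orbitCoordRep (powFormLex ℂ (1 + e) 1) 1) χ).subtype
          (⨆ p : Weight (MatIdx (1 + e)) × Weight (MatIdx (1 + e)),
            ⨆ (_ : p.1 + p.2 = χ ∧ p.1 ≠ 0 ∧ p.2 ≠ 0),
              highestWeightSpace (orbitCoordRep (powFormLex ℂ (1 + e) 1) 1) p.1 *
                highestWeightSpace (orbitCoordRep (powFormLex ℂ (1 + e) 1) 1) p.2)) ≠ 0) :
    -(Weight.size χ) ≤ ((1 : ℕ) : ℤ) * 2 ^ ((Nat.log 2 1 + c₀) ^ c₀) :=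
  (neg_size_le_one_of_genType_rowOne (1 + e) hγ).trans (one_le_rowOne_bound c₀)

/-- **`stub_sliceGen`, row `m = 1`** (every `e`, every final-segment embedding `ι`, every exponent
`c₀`): slice generator types `ext_ι χ` of `A(Δ_1(tr X_{1+e}))` have `-|χ| ≤ 1 · 2^((log₂ 1 + c₀)^c₀)`.
[folklore] -/
theorem stub_sliceGen_rowOne (c₀ e : ℕ) (ι : MatIdx 1 → MatIdx (1 + e)) (hι : StrictMono ι)
    (χ : Weight (MatIdx 1))
    (hγ : Module.finrank ℂ
      (↥(highestWeightSpace (orbitCoordRep (powFormLex ℂ (1 + e) 1) 1) (Function.extend ι χ 0)) ⧸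
        Submodule.comap
          (highestWeightSpace (orbitCoordRep (powFormLex ℂ (1 + e) 1) 1) (Function.extend ι χ 0)).subtype
          (⨆ p : Weight (MatIdx (1 + e)) × Weight (MatIdx (1 + e)),
            ⨆ (_ : p.1 + p.2 = (Function.extend ι χ 0) ∧ p.1 ≠ 0 ∧ p.2 ≠ 0),
              highestWeightSpace (orbitCoordRep (powFormLex ℂ (1 + e) 1) 1) p.1 *
                highestWeightSpace (orbitCoordRep (powFormLex ℂ (1 + e) 1) 1) p.2)) ≠ 0) :
    -(Weight.size χ) ≤ ((1 : ℕ) : ℤ) * 2 ^ ((Nat.log 2 1 + c₀) ^ c₀) := by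
  rw [← Summit.ValiantsHypothesis.ValiantsHypothesis.Theorems.GenInheritance.size_extend hι.injective χ]
  exact powGenDegreeQP_rowOne c₀ e _ hγ

/-- **Occurring weights of `Δ_1(tr X_n)` vanish below the greatest letter**: if `χ` occurs and
`x < y` for some letter `y` then `χ_x = 0` (any `n`). [folklore] -/
theorem apply_eq_zero_of_occurs_rowOne (n : ℕ) {χ : Weight (MatIdx n)}
    (hχ : highestWeightSpace (orbitCoordRep (powFormLex ℂ n 1) 1) χ ≠ ⊥) {x y : MatIdx n}
    (hxy : x < y) : χ x = 0 := by
  cases n with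
  | zero => exact ((ofLex x).1).elim0
  | succ n =>
    have hxT : x ≠ toLex (Fin.last n, Fin.last n) :=
      ne_of_lt (lt_of_lt_of_le hxy (le_toLex_last n y))
    rw [eq_single_top_of_occurs_powFormLex_one n hχ, Pi.single_eq_of_ne hxT]

/-- **No wide generator type at `m = 1`**: a generator type of `A(Δ_1(tr X_{1+e}))` is supported at
the greatest letter, which lies in every nonempty upper set `range ι`; so the wide regime of
`stub_wideGen` is EMPTY in the bottom row. [folklore] -/
theorem not_wide_genType_rowOne (e : ℕ) (ι : MatIdx 1 → MatIdx (1 + e))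
    (hup : IsUpperSet (Set.range ι)) (χ : Weight (MatIdx (1 + e)))
    (hwide : ∃ x, x ∉ Set.range ι ∧ χ x ≠ 0)
    (hγ : Module.finrank ℂ
      (↥(highestWeightSpace (orbitCoordRep (powFormLex ℂ (1 + e) 1) 1) χ) ⧸
        Submodule.comap (highestWeightSpace (orbitCoordRep (powFormLex ℂ (1 + e) 1) 1) χ).subtype
          (⨆ p : Weight (MatIdx (1 + e)) × Weight (MatIdx (1 + e)),
            ⨆ (_ : p.1 + p.2 = χ ∧ p.1 ≠ 0 ∧ p.2 ≠ 0),
              highestWeightSpace (orbitCoordRep (powFormLex ℂ (1 + e) 1) 1) p.1 *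
                highestWeightSpace (orbitCoordRep (powFormLex ℂ (1 + e) 1) 1) p.2)) ≠ 0) :
    False := by
  obtain ⟨x, hx, hχx⟩ := hwide
  have hocc := ne_bot_of_finrank_quotient_ne_zero _ _ hγ
  have hlt : x < ι (toLex ((0 : Fin 1), (0 : Fin 1))) := by
    by_contra hle
    rw [not_lt] at hle
    exact hx (hup hle ⟨_, rfl⟩)
  exact hχx (apply_eq_zero_of_occurs_rowOne (1 + e) hocc hlt)

/-- **`stub_wideGen`, row `m = 1`** (every `e`, `ι`, `c₀`), in the registered shape: vacuous by
`not_wide_genType_rowOne`. [folklore] -/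
theorem stub_wideGen_rowOne (c₀ e : ℕ) (ι : MatIdx 1 → MatIdx (1 + e)) (hup : IsUpperSet (Set.range ι))
    (χ : Weight (MatIdx (1 + e))) (hwide : ∃ x, x ∉ Set.range ι ∧ χ x ≠ 0)
    (hγ : Module.finrank ℂ
      (↥(highestWeightSpace (orbitCoordRep (powFormLex ℂ (1 + e) 1) 1) χ) ⧸
        Submodule.comap (highestWeightSpace (orbitCoordRep (powFormLex ℂ (1 + e) 1) 1) χ).subtype
          (⨆ p : Weight (MatIdx (1 + e)) × Weight (MatIdx (1 + e)),
            ⨆ (_ : p.1 + p.2 = χ ∧ p.1 ≠ 0 ∧ p.2 ≠ 0),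
              highestWeightSpace (orbitCoordRep (powFormLex ℂ (1 + e) 1) 1) p.1 *
                highestWeightSpace (orbitCoordRep (powFormLex ℂ (1 + e) 1) 1) p.2)) ≠ 0) :
    -(Weight.size χ) ≤ ((1 : ℕ) : ℤ) * 2 ^ ((Nat.log 2 1 + c₀) ^ c₀) :=
  (not_wide_genType_rowOne e ι hup χ hwide hγ).elim

end RowOne

end

end Summit.ValiantsHypothesis.ValiantsHypothesis.Theorems.GeneratorObstructions.PowGenDegreeQP
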